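import Literature.AlgebraicGeometry.Hyperkaehler.K3HilbertMukaiLatticeEmbedding
import Literature.Topology.FourManifolds.LatticeFormsWallGenerators
import Literature.Topology.FourManifolds.LatticeFormsPrimitiveEmbeddingHyperbolicComplement
import Literature.Topology.FourManifolds.LatticeFormsUnimodularSummand
import HarnessLib

/-!
# Markman's representatives `ι_{r,s}` of the `O(Λ̃)`-orbits of primitive embeddings `Λ_n ↪ Λ̃`
# (Markman, *Integral constraints on the monodromy group of the hyperkähler resolution of a symmetric product
# of a K3 surface*, Int. J. Math. 21 (2010), §4.1 Lemma 4.3 (1))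

Layer `Literature/AlgebraicGeometry/Hyperkaehler`. Written for lane `lit-hodgefound` (Track 2 foundations; prover seat
`lit-hodgefound-p18`, gen 48, row g48-#3). Sequel of `K3HilbertMukaiLatticeEmbedding.lean` (g47-#8: the model
`ι₀ = ι_{1,n−1} : B₀ ⊕ ⟨−2t⟩ ↪ B₀ ⊕ U` and the stabiliser), `K3HilbertMukaiLatticeEmbeddingTransitive.lean` (g47-#9:
`O(Λ̃) × O(Λ_n)` acts transitively) and `K3HilbertMukaiLatticeEmbeddingOrbits.lean` (g47-#10: the number of
`O(Λ̃)`-orbits is `2^{ρ(n−1)−1}`). THEOREMS ONLY — no definition, no named fact, no instance, no notation.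

## Source, verbatim (E. Markman, Int. J. Math. 21 (2010); held text `paper:arxiv-math_0601304` pp. 19–20)

"Let `𝒫_n` be the subset of `ℤ ⊕ ℤ` given by `𝒫_n := {(r,s) : −s ≥ r > 0, rs = 1−n, and gcd(r,s) = 1}`. The
cardinality of `𝒫_n` is clearly `2^{ρ(n−1)−1}`. Let `U` be the rank `2` hyperbolic lattice […]. Then `O(U)` is
isomorphic to `ℤ/2ℤ × ℤ/2ℤ`. The set `𝒫_n` consists of one representative from each `O(U)`-orbit of primitive elements
of `U` of square-length `2n−2`. For each `(r,s)` in `𝒫_n`, let `ι_{r,s} : Λ ↪ Λ̃` be the isometric embedding, which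
restricts to `H²(S,ℤ)` as the identity, and sends `(1,0,n−1)` to `(r,0,−s)`. The image of `ι_{r,s}` is `(r,0,s)^⊥`.
**Lemma 4.3.** (1) The map `(r,s) ↦ ι_{r,s}` induces a one-to-one correspondence, between the set `𝒫_n` and the set of
`O(Λ̃)`-orbits in `O(Λ,Λ̃)`. […] *Proof.* (1) Suppose `ι_{r₂,s₂} = g ∘ ι_{r₁,s₁}`, for some `g ∈ O(Λ̃)`. Then `g` leaves
`H²(S,ℤ)` invariant and restricts to `H²(S,ℤ)` as the identity. Hence, `g` comes from an isometry of the hyperbolic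
plane `U`, which takes `(r₁,−s₁)` to `(r₂,−s₂)`. Consequently, `(r₁,s₁)` and `(r₂,s₂)` also belong to the same `O(U)`
orbit. Each being the unique representative in `𝒫_n`, we conclude the equality `(r₁,s₁) = (r₂,s₂)`. Let
`ι : Λ ↪ Λ̃` be an isometric embedding. There is a unique `O(Λ̃)`-orbit of isometric embeddings of the unimodular
lattice `H²(S,ℤ)` in `Λ̃` ([Nik] Theorem 1.14.4). Hence, there is an isometry `g ∈ O(Λ̃)`, such that `g ∘ ι`
restricts to `H²(S,ℤ)` as the inclusion. Then `g(ι(1,0,n−1))` belongs to the orthogonal complement `H²(S,ℤ)^⊥` in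
`Λ̃`. Now `H²(S,ℤ)^⊥` is the hyperbolic plane and `Λ̃` is an orthogonal direct sum `H²(S,ℤ) ⊕ H²(S,ℤ)^⊥`. Composing
`g ∘ ι` with an isometry of `H²(S,ℤ)^⊥`, we get `ι_{r,s}`, for some `(r,s) ∈ 𝒫_n`."

## Rendering

As in g47-#8 §2: `Λ = Λ_n ≅ B₀ ⊕ ⟨−2t⟩` on `M × ℤ` (form `B₀.prod ((−2t) • mul)`, `t = n − 1`, `B₀ = H²(S, ℤ)`
symmetric even unimodular), `Λ̃ ≅ B₀ ⊕ U` on `M × ℤ²` (form `B₀.prod hyperbolicForm`, `U(v, w) = v₀ w₁ + v₁ w₀`,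
isotropic basis `e = (1,0)`, `f = (0,1)`). With POSITIVE integers `r, s`, `r s = t` (Markman's `(r, s)` is our
`(r, −s)`), `ι_{r,s} := id_{B₀} × (c ↦ c (r e − s f))`, written out as
`(LinearMap.id).prodMap (LinearMap.toSpanSingleton ℤ (Fin 2 → ℤ) ![r, −s])`; `ι_{1,t}` is g47-#8's `ι₀`. The
normalisation "`−s ≥ r`" (one representative per unordered pair `{r, s}`) is replaced by the explicit statement that
`ι_{r,s}` and `ι_{r',s'}` are `O(Λ̃)`-equivalent iff `(r', s') ∈ {(r, s), (s, r)}`.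

## Contents (all proved)

* §1 (namespace `Literature.Topology.FourManifolds`; any `B₀`) the family `ι_{r,s}`: values, isometric
  (`(r e − s f)² = −2rs`), injective, orthogonal to `v_{r,s} = r e + s f` of square `2rs`; for COPRIME `r, s` the image is
  `v_{r,s}^⊥` and is saturated ("primitive isometric embeddings"); for non-coprime `r, s` it is NOT saturated
  (`exists_smul_mem_range_prodMap_pair_not_mem`) — the condition `gcd(r,s) = 1` of `𝒫_n`.
* §2 (`B₀` non-degenerate) INJECTIVITY of Lemma 4.3 (1): if `f ∘ ι_{r,s} = ι_{r',s'}` for an `f ∈ O(B₀ ⊕ U)` then `f` is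
  the identity on `B₀ ⊕ 0`, preserves `0 ⊕ U` and induces `φ ∈ O(U) = {±1, ±σ}` (tree: `hyperbolicForm_isometryEquiv_eq`)
  with `φ(r, −s) = (r', −s')`, whence `(r', s') = (r, s)` or `(s, r)` (`eq_or_eq_swap_of_isometryEquiv_comp_prodMap_toSpanSingleton_pair`);
  conversely `(1 × (−σ)) ∘ ι_{r,s} = ι_{s,r}`; together `exists_isometryEquiv_comp_prodMap_toSpanSingleton_pair_iff`.
* §3 (`B₀` symmetric even unimodular on a finite free `M`, `t ≥ 1`) SURJECTIVITY of Lemma 4.3 (1): every injective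
  isometric `κ : B₀ ⊕ ⟨−2t⟩ → B₀ ⊕ U` with saturated image satisfies `f ∘ κ = ι_{r,s}` for some `f ∈ O(B₀ ⊕ U)` and
  coprime positive `r, s` with `r s = t` (`exists_isometryEquiv_comp_eq_prodMap_toSpanSingleton_pair`) — `κ|_{B₀}` is a primitive
  embedding of the unimodular `B₀` (unimodular images are saturated), conjugate to the inclusion `B₀ ⊕ 0` by the tree's
  form of Nikulin 1.14.4 for `Λ' ⊕ U` (`exists_isometryEquiv_comp_eq_of_primitive_prod_hyperbolicForm`); then `κ(δ)` lies
  in `(B₀ ⊕ 0)^⊥ = 0 ⊕ U`, equals `(a, b)` with `ab = −t`, `gcd(a, b) = 1` by saturation, and `−1_U` fixes the sign.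
* §4 (namespace `Literature.AlgebraicGeometry.Hyperkaehler`) the reading for `Λ_n = Λ(K3^{[n]}) ↪ Λ̃ = E₈(−1)^{⊕2} ⊕ U^{⊕4}`,
  `n ≥ 2`: a family of embeddings indexed by the positive factorisations `r s = n − 1`, primitive iff coprime, pairwise
  `O(Λ̃)`-equivalent iff `{r,s} = {r',s'}`, and meeting every `O(Λ̃)`-orbit of primitive embeddings
  (`k3HilbertLattice_embedding_mukaiLattice_representatives`).

NOT here: the count `|𝒫_n| = 2^{ρ(n−1)−1}` (the orbit count is g47-#10's
`k3HilbertLattice_natCard_quot_embedding_mukaiLattice`); Lemma 4.3 (2) (g47-#8, g47-#9).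
-/

noncomputable section

open Module Function
open LinearMap (BilinForm)

/-! ### §1 The family `ι_{r,s} : B₀ ⊕ ⟨−2rs⟩ → B₀ ⊕ U`, `(x, c) ↦ (x, c(r e − s f))` -/

namespace Literature.Topology.FourManifolds

open LinearMap.BilinForm

section Family

variable {M : Type*} [AddCommGroup M] (B₀ : BilinForm ℤ M) (r s : ℕ)

/-- **`ι_{r,s} (x, c) = (x, (c r, −c s))`** ("restricts to `H²(S, ℤ)` as the identity, and sends `(1, 0, n−1)` to
`(r, 0, −s)`"). [cite: Markman2010Constraints, §4.1 (the embeddings `ι_{r,s}`)] -/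
theorem prodMap_toSpanSingleton_pair_apply (x : M) (c : ℤ) :
    ((LinearMap.id : M →ₗ[ℤ] M).prodMap (LinearMap.toSpanSingleton ℤ (Fin 2 → ℤ) ![(r : ℤ), -(s : ℤ)])) (x, c) =
      (x, c • ![(r : ℤ), -(s : ℤ)]) := by
  simp [LinearMap.prodMap_apply, LinearMap.toSpanSingleton_apply]

/-- **`ι_{r,s}` is isometric from `B₀ ⊕ ⟨−2t⟩`, `t = r s`** (`(r e − s f)² = −2rs`).
[cite: Markman2010Constraints, §4.1 ("`ι_{r,s} : Λ ↪ Λ̃` be the isometric embedding")] -/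
theorem prod_hyperbolicForm_apply_prodMap_toSpanSingleton_pair {t : ℕ} (hrs : r * s = t) (p q : M × ℤ) :
    (B₀.prod hyperbolicForm)
        (((LinearMap.id : M →ₗ[ℤ] M).prodMap (LinearMap.toSpanSingleton ℤ (Fin 2 → ℤ) ![(r : ℤ), -(s : ℤ)])) p)
        (((LinearMap.id : M →ₗ[ℤ] M).prodMap (LinearMap.toSpanSingleton ℤ (Fin 2 → ℤ) ![(r : ℤ), -(s : ℤ)])) q) =
      (B₀.prod ((-(2 * t : ℤ)) • LinearMap.mul ℤ ℤ)) p q := by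
  obtain ⟨x, c⟩ := p
  obtain ⟨y, d⟩ := q
  rw [prodMap_toSpanSingleton_pair_apply, prodMap_toSpanSingleton_pair_apply, LinearMap.BilinForm.prod_apply,
    LinearMap.BilinForm.prod_apply, hyperbolicForm_apply, ← hrs]
  simp
  ring

/-- **`ι_{r,s}` is injective** (`r > 0`). [cite: Markman2010Constraints, §4.1 Lemma 4.3] -/
theorem injective_prodMap_toSpanSingleton_pair (hr : 0 < r) :
    Injective ((LinearMap.id : M →ₗ[ℤ] M).prodMap (LinearMap.toSpanSingleton ℤ (Fin 2 → ℤ) ![(r : ℤ), -(s : ℤ)])) := by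
  rintro ⟨x, c⟩ ⟨y, d⟩ h
  rw [prodMap_toSpanSingleton_pair_apply, prodMap_toSpanSingleton_pair_apply, Prod.mk.injEq] at h
  obtain ⟨rfl, h2⟩ := h
  have h3 := congrFun h2 0
  simp at h3
  rcases h3 with h3 | h3
  · rw [h3]
  · omega

/-- **`v_{r,s} = r e + s f` has `(v, v) = 2t`**, `t = r s` ("primitive elements of `U` of square-length `2n−2`").
[cite: Markman2010Constraints, §4.1 ("The image of `ι_{r,s}` is `(r,0,s)^⊥`")] -/
theorem prod_hyperbolicForm_pair_self {t : ℕ} (hrs : r * s = t) :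
    (B₀.prod hyperbolicForm) ((0 : M), ![(r : ℤ), (s : ℤ)]) ((0 : M), ![(r : ℤ), (s : ℤ)]) = 2 * t := by
  rw [LinearMap.BilinForm.prod_apply, hyperbolicForm_apply, ← hrs]
  simp
  ring

/-- **The image of `ι_{r,s}` is orthogonal to `v_{r,s} = r e + s f`.** [cite: Markman2010Constraints, §4.1 ("The image of `ι_{r,s}` is `(r,0,s)^⊥`")] -/
theorem range_prodMap_toSpanSingleton_pair_le_orthogonal :
    LinearMap.range ((LinearMap.id : M →ₗ[ℤ] M).prodMap
        (LinearMap.toSpanSingleton ℤ (Fin 2 → ℤ) ![(r : ℤ), -(s : ℤ)])) ≤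
      (B₀.prod hyperbolicForm).orthogonal (ℤ ∙ ((0 : M), ![(r : ℤ), (s : ℤ)])) := by
  rintro _ ⟨⟨x, c⟩, rfl⟩
  rw [mem_orthogonal_span_singleton_iff, LinearMap.BilinForm.prod_apply, hyperbolicForm_apply,
    prodMap_toSpanSingleton_pair_apply]
  simp
  ring

/-- **For coprime `r, s` the image of `ι_{r,s}` is `v_{r,s}^⊥`**: `(x, (a, b)) ⊥ (0, (r, s))` iff `r b + s a = 0` iff
`(a, b) = c (r, −s)` (`gcd(r, s) = 1`, `r > 0`). [cite: Markman2010Constraints, §4.1 ("The image of `ι_{r,s}` is `(r,0,s)^⊥`")] -/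
theorem range_prodMap_toSpanSingleton_pair_eq_orthogonal (hr : 0 < r) (hcop : Nat.Coprime r s) :
    LinearMap.range ((LinearMap.id : M →ₗ[ℤ] M).prodMap
        (LinearMap.toSpanSingleton ℤ (Fin 2 → ℤ) ![(r : ℤ), -(s : ℤ)])) =
      (B₀.prod hyperbolicForm).orthogonal (ℤ ∙ ((0 : M), ![(r : ℤ), (s : ℤ)])) := by
  refine le_antisymm (range_prodMap_toSpanSingleton_pair_le_orthogonal B₀ r s) ?_
  rintro ⟨x, w⟩ hw
  rw [mem_orthogonal_span_singleton_iff, LinearMap.BilinForm.prod_apply, hyperbolicForm_apply] at hw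
  simp only [map_zero, LinearMap.zero_apply, zero_add, Matrix.cons_val_zero, Matrix.cons_val_one] at hw
  -- `r w₁ + s w₀ = 0`; `gcd(r, s) = 1` ⟹ `r ∣ w₀`
  have hcopZ : IsCoprime (r : ℤ) (s : ℤ) := Nat.isCoprime_iff_coprime.2 hcop
  have hdvd : (r : ℤ) ∣ (s : ℤ) * w 0 := ⟨-w 1, by linear_combination hw⟩
  obtain ⟨c, hc⟩ := hcopZ.dvd_of_dvd_mul_left hdvd
  have hr' : (r : ℤ) ≠ 0 := by exact_mod_cast hr.ne'
  have hw1 : w 1 = -(s : ℤ) * c := by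
    have h : (r : ℤ) * w 1 = (r : ℤ) * (-(s : ℤ) * c) := by linear_combination hw - (s : ℤ) * hc
    exact mul_left_cancel₀ hr' h
  refine ⟨(x, c), ?_⟩
  rw [prodMap_toSpanSingleton_pair_apply, Prod.mk.injEq]
  refine ⟨rfl, funext fun i ↦ ?_⟩
  fin_cases i
  · simp [hc, mul_comm]
  · simp [hw1, mul_comm]

/-- **For coprime `r, s` the image of `ι_{r,s}` is saturated** (it is an orthogonal complement) — `ι_{r,s}` is a
PRIMITIVE isometric embedding. [cite: Markman2010Constraints, §4.1 ("the set of primitive isometric embeddings")] -/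
theorem mem_range_prodMap_toSpanSingleton_pair_of_smul_mem (hr : 0 < r) (hcop : Nat.Coprime r s) (k : ℤ)
    (z : M × (Fin 2 → ℤ)) (hk : k ≠ 0)
    (hz : k • z ∈ LinearMap.range ((LinearMap.id : M →ₗ[ℤ] M).prodMap
      (LinearMap.toSpanSingleton ℤ (Fin 2 → ℤ) ![(r : ℤ), -(s : ℤ)]))) :
    z ∈ LinearMap.range ((LinearMap.id : M →ₗ[ℤ] M).prodMap
      (LinearMap.toSpanSingleton ℤ (Fin 2 → ℤ) ![(r : ℤ), -(s : ℤ)])) := by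
  rw [range_prodMap_toSpanSingleton_pair_eq_orthogonal (0 : BilinForm ℤ M) r s hr hcop,
    mem_orthogonal_span_singleton_iff] at hz ⊢
  rw [map_smul, smul_eq_mul] at hz
  exact (mul_eq_zero.1 hz).resolve_left hk

/-- **For NON-coprime `r, s` the image of `ι_{r,s}` is NOT saturated**: with `g = gcd(r,s) > 1`,
`z = (0, (r/g, −s/g))` has `g z = (0, (r, −s)) ∈ im ι_{r,s}` but `z ∉ im ι_{r,s}` — the condition `gcd(r, s) = 1` in
`𝒫_n`. [cite: Markman2010Constraints, §4.1 (definition of `𝒫_n`)] -/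
theorem exists_smul_mem_range_prodMap_pair_not_mem (hr : 0 < r) (hg : 1 < Nat.gcd r s) :
    ∃ (k : ℤ) (z : M × (Fin 2 → ℤ)), k ≠ 0 ∧
      k • z ∈ LinearMap.range ((LinearMap.id : M →ₗ[ℤ] M).prodMap
        (LinearMap.toSpanSingleton ℤ (Fin 2 → ℤ) ![(r : ℤ), -(s : ℤ)])) ∧
      z ∉ LinearMap.range ((LinearMap.id : M →ₗ[ℤ] M).prodMap
        (LinearMap.toSpanSingleton ℤ (Fin 2 → ℤ) ![(r : ℤ), -(s : ℤ)])) := by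
  set g := Nat.gcd r s with hg'
  obtain ⟨r', hr'⟩ : g ∣ r := Nat.gcd_dvd_left r s
  obtain ⟨s', hs'⟩ : g ∣ s := Nat.gcd_dvd_right r s
  have hg0 : (g : ℤ) ≠ 0 := by exact_mod_cast (by omega : g ≠ 0)
  refine ⟨g, ((0 : M), ![(r' : ℤ), -(s' : ℤ)]), hg0, ⟨((0 : M), (1 : ℤ)), ?_⟩, ?_⟩
  · rw [prodMap_toSpanSingleton_pair_apply, Prod.smul_mk, smul_zero, Prod.mk.injEq]
    refine ⟨rfl, funext fun i ↦ ?_⟩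
    fin_cases i
    · simp [hr']
    · simp [hs']
  · rintro ⟨⟨x, c⟩, hc⟩
    rw [prodMap_toSpanSingleton_pair_apply, Prod.mk.injEq] at hc
    have h0 := congrFun hc.2 0
    simp only [Pi.smul_apply, Matrix.cons_val_zero, smul_eq_mul] at h0
    -- `c r = r' = r / g` with `g > 1`, `r > 0`: impossible
    have hr'0 : 0 < r' := Nat.pos_of_ne_zero fun h ↦ by simp [h] at hr'; omega
    have h1 : c * (g : ℤ) * (r' : ℤ) = (r' : ℤ) := by
      rw [mul_assoc, ← Nat.cast_mul, ← hr', h0]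
    have h2 : c * (g : ℤ) = 1 := by
      have hr'z : (r' : ℤ) ≠ 0 := by exact_mod_cast hr'0.ne'
      calc c * (g : ℤ) = c * (g : ℤ) * (r' : ℤ) / (r' : ℤ) := by rw [Int.mul_ediv_cancel _ hr'z]
        _ = 1 := by rw [h1, Int.ediv_self hr'z]
    have h3 : (g : ℤ) ∣ 1 := ⟨c, by linear_combination -h2⟩
    have h4 : g ∣ 1 := by exact_mod_cast h3
    have h5 : g = 1 := Nat.dvd_one.1 h4
    omega

end Family

/-! ### §2 Injectivity of Lemma 4.3 (1): `f ∘ ι_{r,s} = ι_{r',s'}` forces `{r', s'} = {r, s}` -/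

section Injectivity

variable {M : Type*} [AddCommGroup M] (B₀ : BilinForm ℤ M)

/-- **`(1 × (−σ)) ∘ ι_{r,s} = ι_{s,r}`**: the isometry `−σ ∈ O(U)` (`σ` the swap of `e`, `f`) exchanges the two
embeddings of an unordered pair ("one representative from each `O(U)`-orbit").
[cite: Markman2010Constraints, §4.1 proof of Lemma 4.3 (1)] -/
theorem prodCongr_swap_neg_apply_prodMap_toSpanSingleton_pair (r s : ℕ) (p : M × ℤ) :
    (LinearMap.BilinForm.IsometryEquiv.refl B₀).prodCongr (hyperbolicSwap.trans (LinearMap.BilinForm.IsometryEquiv.neg hyperbolicForm))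
        (((LinearMap.id : M →ₗ[ℤ] M).prodMap (LinearMap.toSpanSingleton ℤ (Fin 2 → ℤ) ![(r : ℤ), -(s : ℤ)])) p) =
      ((LinearMap.id : M →ₗ[ℤ] M).prodMap (LinearMap.toSpanSingleton ℤ (Fin 2 → ℤ) ![(s : ℤ), -(r : ℤ)])) p := by
  obtain ⟨x, c⟩ := p
  rw [prodMap_toSpanSingleton_pair_apply, prodMap_toSpanSingleton_pair_apply, IsometryEquiv.prodCongr_apply,
    Prod.mk.injEq]
  refine ⟨rfl, ?_⟩
  rw [LinearMap.BilinForm.IsometryEquiv.trans_apply, hyperbolicSwap_apply, LinearMap.BilinForm.IsometryEquiv.neg_apply]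
  funext i
  fin_cases i <;> simp

/-- **Injectivity of `{r, s} ↦ [ι_{r,s}]`** (`B₀` non-degenerate; `r, r' > 0`): if `f ∘ ι_{r,s} = ι_{r',s'}` for an
`f ∈ O(B₀ ⊕ U)`, then `(r', s') = (r, s)` or `(r', s') = (s, r)` — "`g` leaves `H²(S,ℤ)` invariant and restricts to
`H²(S,ℤ)` as the identity. Hence, `g` comes from an isometry of the hyperbolic plane `U`, which takes `(r₁,−s₁)` to
`(r₂,−s₂)`" and `O(U) = {±1, ±σ}`. [cite: Markman2010Constraints, §4.1 Lemma 4.3 (1) and its proof] -/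
theorem eq_or_eq_swap_of_isometryEquiv_comp_prodMap_toSpanSingleton_pair (hB : B₀.Nondegenerate) {r s r' s' : ℕ}
    (hr : 0 < r) (hr' : 0 < r') (f : (B₀.prod hyperbolicForm).IsometryEquiv (B₀.prod hyperbolicForm))
    (hf : ∀ p, f (((LinearMap.id : M →ₗ[ℤ] M).prodMap
        (LinearMap.toSpanSingleton ℤ (Fin 2 → ℤ) ![(r : ℤ), -(s : ℤ)])) p) =
      ((LinearMap.id : M →ₗ[ℤ] M).prodMap (LinearMap.toSpanSingleton ℤ (Fin 2 → ℤ) ![(r' : ℤ), -(s' : ℤ)])) p) :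
    (r' = r ∧ s' = s) ∨ (r' = s ∧ s' = r) := by
  -- `f` is the identity on `B₀ ⊕ 0`
  have hfx : ∀ x : M, f (x, 0) = (x, 0) := fun x ↦ by
    have h := hf (x, 0)
    rwa [prodMap_toSpanSingleton_pair_apply, prodMap_toSpanSingleton_pair_apply, zero_smul, zero_smul] at h
  -- `f (r e − s f) = r' e − s' f`
  have hfδ : f ((0 : M), ![(r : ℤ), -(s : ℤ)]) = ((0 : M), ![(r' : ℤ), -(s' : ℤ)]) := by
    have h := hf (0, 1)
    rwa [prodMap_toSpanSingleton_pair_apply, prodMap_toSpanSingleton_pair_apply, one_smul, one_smul] at h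
  -- `f` preserves `0 ⊕ U = (B₀ ⊕ 0)^⊥`
  have hf1 : ∀ u : Fin 2 → ℤ, (f ((0 : M), u)).1 = 0 := fun u ↦ by
    refine hB.2 _ fun x ↦ ?_
    have h := f.map_app ((0 : M), u) (x, 0)
    rw [hfx, LinearMap.BilinForm.prod_apply, LinearMap.BilinForm.prod_apply] at h
    simpa [hyperbolicForm_apply] using h
  -- the induced isometry `φ` of `U`
  set φₗ : (Fin 2 → ℤ) →ₗ[ℤ] (Fin 2 → ℤ) :=
    (LinearMap.snd ℤ M (Fin 2 → ℤ)) ∘ₗ (f.toLinearEquiv : M × (Fin 2 → ℤ) →ₗ[ℤ] M × (Fin 2 → ℤ)) ∘ₗ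
      LinearMap.inr ℤ M (Fin 2 → ℤ) with hφₗ
  have hφ : ∀ u, f ((0 : M), u) = ((0 : M), φₗ u) := fun u ↦ Prod.ext (hf1 u) rfl
  have hφiso : ∀ u w, hyperbolicForm (φₗ u) (φₗ w) = hyperbolicForm u w := fun u w ↦ by
    have h := f.map_app ((0 : M), w) ((0 : M), u)
    rw [hφ, hφ, LinearMap.BilinForm.prod_apply, LinearMap.BilinForm.prod_apply] at h
    simpa using h
  have hφinj : Function.Injective φₗ := fun u w h ↦ by
    have h' : f ((0 : M), u) = f ((0 : M), w) := by rw [hφ, hφ, h]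
    exact (Prod.mk.inj (f.toLinearEquiv.injective h')).2
  have hφsurj : Function.Surjective φₗ := fun w ↦ by
    obtain ⟨⟨y, u⟩, hyu⟩ : ∃ q, f q = ((0 : M), w) := ⟨f.symm ((0 : M), w), f.toLinearEquiv.apply_symm_apply _⟩
    have hsplit : f (y, u) = f (y, 0) + f ((0 : M), u) := by rw [← map_add, Prod.mk_add_mk, add_zero, zero_add]
    rw [hsplit, hfx, hφ, Prod.mk_add_mk, add_zero, zero_add, Prod.mk.injEq] at hyu
    exact ⟨u, hyu.2⟩
  let φ : hyperbolicForm.IsometryEquiv hyperbolicForm :=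
    { LinearEquiv.ofBijective φₗ ⟨hφinj, hφsurj⟩ with map_app' := fun u w ↦ hφiso u w }
  have hφapply : ∀ u, φ u = φₗ u := fun _ ↦ rfl
  have key : φ ![(r : ℤ), -(s : ℤ)] = ![(r' : ℤ), -(s' : ℤ)] := by
    rw [hφapply]
    have h := hfδ
    rw [hφ, Prod.mk.injEq] at h
    exact h.2
  rcases hyperbolicForm_isometryEquiv_eq φ with h | h | h | h <;> rw [h] at key
  · have h0 := congrFun key 0
    have h1 := congrFun key 1
    change (r : ℤ) = r' at h0
    change -(s : ℤ) = -(s' : ℤ) at h1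
    left
    constructor <;> omega
  · rw [LinearMap.BilinForm.IsometryEquiv.neg_apply] at key
    have h0 := congrFun key 0
    simp only [Pi.neg_apply, Matrix.cons_val_zero] at h0
    omega
  · rw [hyperbolicSwap_apply] at key
    have h0 := congrFun key 0
    simp only [Matrix.cons_val_zero, Matrix.cons_val_one] at h0
    omega
  · rw [LinearMap.BilinForm.IsometryEquiv.trans_apply, hyperbolicSwap_apply,
      LinearMap.BilinForm.IsometryEquiv.neg_apply] at key
    have h0 := congrFun key 0
    have h1 := congrFun key 1
    simp only [Pi.neg_apply, Matrix.cons_val_zero, Matrix.cons_val_one] at h0 h1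
    right
    constructor <;> omega

/-- **Lemma 4.3 (1), injectivity, as an iff** (`B₀` non-degenerate; `r, r' > 0`): `ι_{r,s}` and `ι_{r',s'}` lie
in the same `O(B₀ ⊕ U)`-orbit iff `{r', s'} = {r, s}`. [cite: Markman2010Constraints, §4.1 Lemma 4.3 (1)] -/
theorem exists_isometryEquiv_comp_prodMap_toSpanSingleton_pair_iff (hB : B₀.Nondegenerate) {r s r' s' : ℕ}
    (hr : 0 < r) (hr' : 0 < r') :
    (∃ f : (B₀.prod hyperbolicForm).IsometryEquiv (B₀.prod hyperbolicForm), ∀ p,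
        f (((LinearMap.id : M →ₗ[ℤ] M).prodMap
          (LinearMap.toSpanSingleton ℤ (Fin 2 → ℤ) ![(r : ℤ), -(s : ℤ)])) p) =
          ((LinearMap.id : M →ₗ[ℤ] M).prodMap
            (LinearMap.toSpanSingleton ℤ (Fin 2 → ℤ) ![(r' : ℤ), -(s' : ℤ)])) p) ↔
      (r' = r ∧ s' = s) ∨ (r' = s ∧ s' = r) := by
  refine ⟨fun ⟨f, hf⟩ ↦ eq_or_eq_swap_of_isometryEquiv_comp_prodMap_toSpanSingleton_pair B₀ hB hr hr' f hf, ?_⟩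
  rintro (⟨rfl, rfl⟩ | ⟨rfl, rfl⟩)
  · exact ⟨LinearMap.BilinForm.IsometryEquiv.refl _, fun p ↦ rfl⟩
  · exact ⟨_, prodCongr_swap_neg_apply_prodMap_toSpanSingleton_pair B₀ _ _⟩

end Injectivity

/-! ### §3 Surjectivity of Lemma 4.3 (1): every primitive embedding is `O(B₀ ⊕ U)`-equivalent to some `ι_{r,s}` -/

section Surjectivity

variable {M : Type*} [AddCommGroup M] [Module.Finite ℤ M] [Module.Free ℤ M] (B₀ : BilinForm ℤ M)

omit [Module.Finite ℤ M] [Module.Free ℤ M] in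
/-- The inclusion `B₀ ⊕ 0 ⊂ B₀ ⊕ U` is a primitive isometric embedding orthogonal to `U`. [folklore] -/
private theorem inl_primitive :
    Injective (LinearMap.inl ℤ M (Fin 2 → ℤ)) ∧
      (∀ p q, (B₀.prod hyperbolicForm) (LinearMap.inl ℤ M (Fin 2 → ℤ) p) (LinearMap.inl ℤ M (Fin 2 → ℤ) q) = B₀ p q) ∧
      (∀ (c : ℤ) (z : M × (Fin 2 → ℤ)), c ≠ 0 → c • z ∈ LinearMap.range (LinearMap.inl ℤ M (Fin 2 → ℤ)) →
        z ∈ LinearMap.range (LinearMap.inl ℤ M (Fin 2 → ℤ))) ∧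
      ∀ p, (LinearMap.inl ℤ M (Fin 2 → ℤ) p).2 = 0 := by
  refine ⟨LinearMap.inl_injective, fun p q ↦ ?_, fun c z hc hz ↦ ?_, fun p ↦ rfl⟩
  · rw [LinearMap.BilinForm.prod_apply]
    simp
  · rw [LinearMap.range_inl, LinearMap.mem_ker, LinearMap.snd_apply] at hz ⊢
    rw [Prod.smul_snd] at hz
    exact (smul_eq_zero.1 hz).resolve_left hc

/-- **Lemma 4.3 (1), surjectivity** (`B₀` symmetric even unimodular on a finite free `ℤ`-module, `t ≥ 1`): every
injective isometric `κ : B₀ ⊕ ⟨−2t⟩ → B₀ ⊕ U` with saturated image is `O(B₀ ⊕ U)`-equivalent to `ι_{r,s}` for some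
positive coprime `r, s` with `r s = t`: `f (κ p) = ι_{r,s} p`. Printed proof: "there is an isometry `g ∈ O(Λ̃)`, such
that `g ∘ ι` restricts to `H²(S,ℤ)` as the inclusion [Nik, Thm. 1.14.4]. Then `g(ι(1,0,n−1))` belongs to the
orthogonal complement `H²(S,ℤ)^⊥` […] the hyperbolic plane […]. Composing `g ∘ ι` with an isometry of
`H²(S,ℤ)^⊥`, we get `ι_{r,s}`" — here: `κ|_{B₀}` has unimodular hence saturated image and is conjugate to the
inclusion by the tree's `exists_isometryEquiv_comp_eq_of_primitive_prod_hyperbolicForm`; `κ(δ) ↦ (a, b) ∈ U` with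
`ab = −t`, `gcd(a,b) = 1` by saturation; `−1_U` makes `a > 0`.
[cite: Markman2010Constraints, §4.1 Lemma 4.3 (1) and its proof] [cite: Nikulin1980, Thm. 1.14.4] -/
theorem exists_isometryEquiv_comp_eq_prodMap_toSpanSingleton_pair (hs : B₀.IsSymm) (hu : B₀.IsUnimodular)
    (he : B₀.IsEven) {t : ℕ} (ht : 0 < t) {κ : M × ℤ →ₗ[ℤ] M × (Fin 2 → ℤ)} (hinj : Injective κ)
    (hκ : ∀ p q, (B₀.prod hyperbolicForm) (κ p) (κ q) = (B₀.prod ((-(2 * t : ℤ)) • LinearMap.mul ℤ ℤ)) p q)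
    (hsat : ∀ (k : ℤ) z, k ≠ 0 → k • z ∈ LinearMap.range κ → z ∈ LinearMap.range κ) :
    ∃ (f : (B₀.prod hyperbolicForm).IsometryEquiv (B₀.prod hyperbolicForm)) (r s : ℕ),
      0 < r ∧ 0 < s ∧ r * s = t ∧ Nat.Coprime r s ∧
      ∀ p, f (κ p) = ((LinearMap.id : M →ₗ[ℤ] M).prodMap
        (LinearMap.toSpanSingleton ℤ (Fin 2 → ℤ) ![(r : ℤ), -(s : ℤ)])) p := by
  haveI : B₀.IsPerfPair := hu
  haveI : IsAddTorsionFree M := IsAddTorsionFree.of_isTorsionFree ℤ M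
  have hC : B₀.Nondegenerate := hu.nondegenerate
  obtain ⟨hι, hιC, hprim, hι₂⟩ := inl_primitive B₀
  -- `κ|_{B₀ ⊕ 0}` is a primitive isometric embedding of the unimodular `B₀`
  set κ₁ : M →ₗ[ℤ] M × (Fin 2 → ℤ) := κ ∘ₗ LinearMap.inl ℤ M ℤ with hκ₁
  have hκ₁apply : ∀ x, κ₁ x = κ (x, 0) := fun _ ↦ rfl
  have hκ₁C : ∀ p q, (B₀.prod hyperbolicForm) (κ₁ p) (κ₁ q) = B₀ p q := fun p q ↦ by
    rw [hκ₁apply, hκ₁apply, hκ, LinearMap.BilinForm.prod_apply]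
    simp
  have hκ₁ : Injective κ₁ := hinj.comp LinearMap.inl_injective
  have hperf : ((B₀.prod hyperbolicForm).restrict (LinearMap.range κ₁)).IsPerfPair :=
    isPerfPair_restrict_range_of_map_eq hκ₁C
  have hκ₁prim : ∀ (c : ℤ) (z : M × (Fin 2 → ℤ)), c ≠ 0 → c • z ∈ LinearMap.range κ₁ → z ∈ LinearMap.range κ₁ :=
    fun c z hc hz ↦ mem_of_zsmul_mem_of_isUnimodular_restrict hperf hc hz
  obtain ⟨φ, hφ⟩ := exists_isometryEquiv_comp_eq_of_primitive_prod_hyperbolicForm B₀ hs hu he hC hι hιC hprim hκ₁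
    hκ₁C hκ₁prim hι₂
  -- `φ (x, 0) = κ (x, 0)`; let `w = φ⁻¹ (κ δ)`
  have hφx : ∀ x : M, φ.symm (κ (x, 0)) = (x, 0) := fun x ↦ by
    rw [← hκ₁apply, ← hφ]
    exact φ.toLinearEquiv.symm_apply_apply _
  set w : M × (Fin 2 → ℤ) := φ.symm (κ ((0 : M), (1 : ℤ))) with hw
  have hφw : φ w = κ ((0 : M), (1 : ℤ)) := φ.toLinearEquiv.apply_symm_apply _
  have hsymm_iso : ∀ a b, (B₀.prod hyperbolicForm) (φ.symm a) (φ.symm b) = (B₀.prod hyperbolicForm) a b :=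
    fun a b ↦ φ.symm.map_app b a
  -- `w ∈ (B₀ ⊕ 0)^⊥ = 0 ⊕ U`
  have hw1 : w.1 = 0 := by
    refine hC.2 _ fun x ↦ ?_
    have h : (B₀.prod hyperbolicForm) (φ.symm (κ (x, 0))) (φ.symm (κ ((0 : M), (1 : ℤ)))) = 0 := by
      rw [hsymm_iso, hκ, LinearMap.BilinForm.prod_apply]
      simp
    rw [hφx, ← hw, LinearMap.BilinForm.prod_apply] at h
    simpa [hyperbolicForm_apply] using h
  -- `w = (0, (a, b))` with `2ab = −2t`
  have hab : w.2 0 * w.2 1 = -(t : ℤ) := by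
    have h : (B₀.prod hyperbolicForm) w w = -(2 * t : ℤ) := by
      rw [hw, hsymm_iso, hκ, LinearMap.BilinForm.prod_apply]
      simp
    rw [LinearMap.BilinForm.prod_apply, hw1, hyperbolicForm_apply] at h
    simp only [map_zero, zero_add] at h
    linarith
  -- `φ⁻¹ (κ (x, c)) = (x, c w₂)`
  have hκ' : ∀ x c, φ.symm (κ (x, c)) = (x, c • w.2) := fun x c ↦ by
    have h : ((x, c) : M × ℤ) = (x, 0) + c • ((0 : M), (1 : ℤ)) := by simp
    rw [h, map_add, map_smul, map_add, map_smul, hφx, ← hw]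
    ext
    · simp [hw1]
    · simp
  -- saturation ⟹ `gcd(a, b) = 1`
  have ha0 : w.2 0 ≠ 0 := fun h ↦ by
    rw [h, zero_mul] at hab
    omega
  have hgcd : Int.gcd (w.2 0) (w.2 1) = 1 := by
    set g := Int.gcd (w.2 0) (w.2 1) with hg
    have hg0 : g ≠ 0 := fun h ↦ ha0 (Int.gcd_eq_zero_iff.1 h).1
    obtain ⟨a', ha'⟩ : (g : ℤ) ∣ w.2 0 := Int.gcd_dvd_left _ _
    obtain ⟨b', hb'⟩ : (g : ℤ) ∣ w.2 1 := Int.gcd_dvd_right _ _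
    -- `z = (0, (a', b'))`, `g z = w ∈ range (φ⁻¹ κ)`
    have hz : (g : ℤ) • φ (((0 : M), ![a', b'])) ∈ LinearMap.range κ := by
      refine ⟨((0 : M), (1 : ℤ)), ?_⟩
      rw [← map_smul, ← hφw]
      congr 1
      ext
      · simp [hw1]
      · rename_i i
        fin_cases i
        · simp [ha']
        · simp [hb']
    obtain ⟨⟨y, c⟩, hyc⟩ := hsat _ _ (by exact_mod_cast hg0) hz
    have hyc' : φ.symm (κ (y, c)) = ((0 : M), ![a', b']) := by
      rw [hyc]
      exact φ.toLinearEquiv.symm_apply_apply _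
    rw [hκ', Prod.mk.injEq] at hyc'
    have h0 := congrFun hyc'.2 0
    simp only [Pi.smul_apply, smul_eq_mul, Matrix.cons_val_zero] at h0
    -- `c a = a'` with `a = g a'`, `a ≠ 0` ⟹ `c g = 1`
    have ha'0 : a' ≠ 0 := fun h ↦ ha0 (by rw [ha', h, mul_zero])
    have h1 : c * (g : ℤ) * a' = a' := by rw [mul_assoc, ← ha', h0]
    have h2 : c * (g : ℤ) = 1 := by
      have := mul_right_cancel₀ ha'0 (h1.trans (one_mul a').symm)
      exact this
    have h3 : (g : ℤ) ∣ 1 := ⟨c, by linear_combination -h2⟩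
    exact Nat.dvd_one.1 (by exact_mod_cast h3)
  have hcop : Nat.Coprime (w.2 0).natAbs (w.2 1).natAbs := by
    rw [Nat.Coprime, ← Int.gcd_eq_natAbs, hgcd]
  have hrs : (w.2 0).natAbs * (w.2 1).natAbs = t := by
    rw [← Int.natAbs_mul, hab, Int.natAbs_neg, Int.natAbs_natCast]
  have hb0 : w.2 1 ≠ 0 := fun h ↦ by
    rw [h, mul_zero] at hab
    omega
  -- fix the sign of `a` with `−1_U`
  rcases lt_or_gt_of_ne ha0 with ha | ha
  · -- `a < 0 < b`: use `φ⁻¹` followed by `1 × (−1)`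
    have hb : 0 < w.2 1 := by
      by_contra hb
      have : 0 ≤ w.2 0 * w.2 1 := mul_nonneg_of_nonpos_of_nonpos ha.le (not_lt.1 hb)
      omega
    refine ⟨φ.symm.trans ((LinearMap.BilinForm.IsometryEquiv.refl B₀).prodCongr (LinearMap.BilinForm.IsometryEquiv.neg hyperbolicForm)), (w.2 0).natAbs,
      (w.2 1).natAbs, Int.natAbs_pos.2 ha0, Int.natAbs_pos.2 hb0, hrs, hcop, fun ⟨x, c⟩ ↦ ?_⟩
    rw [LinearMap.BilinForm.IsometryEquiv.trans_apply, hκ', IsometryEquiv.prodCongr_apply, LinearMap.BilinForm.IsometryEquiv.neg_apply,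
      prodMap_toSpanSingleton_pair_apply, Int.ofNat_natAbs_of_nonpos ha.le, Int.natAbs_of_nonneg hb.le, Prod.mk.injEq]
    refine ⟨rfl, funext fun i ↦ ?_⟩
    fin_cases i <;> simp
  · -- `a > 0 > b`: `φ⁻¹` itself
    have hb : w.2 1 < 0 := by
      by_contra hb
      have : 0 ≤ w.2 0 * w.2 1 := mul_nonneg ha.le (not_lt.1 hb)
      omega
    refine ⟨φ.symm, (w.2 0).natAbs, (w.2 1).natAbs, Int.natAbs_pos.2 ha0, Int.natAbs_pos.2 hb0, hrs, hcop,
      fun ⟨x, c⟩ ↦ ?_⟩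
    rw [hκ', prodMap_toSpanSingleton_pair_apply, Int.natAbs_of_nonneg ha.le, Int.ofNat_natAbs_of_nonpos hb.le, neg_neg,
      Prod.mk.injEq]
    refine ⟨rfl, funext fun i ↦ ?_⟩
    fin_cases i <;> simp

end Surjectivity

end Literature.Topology.FourManifolds

/-! ### §4 `Λ_n = Λ(K3^{[n]}) ↪ Λ̃ = E₈(−1)^{⊕2} ⊕ U^{⊕4}`: Lemma 4.3 (1) -/

namespace Literature.AlgebraicGeometry.Hyperkaehler

open Literature.Topology.FourManifolds Literature.AlgebraicGeometry.Surfaces LinearMap.BilinForm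

/-- **Markman's Lemma 4.3 (1) for `Λ_n ↪ Λ̃`** (`n ≥ 2`; `Λ_n = toBilin' (k3HilbertGram n)`, `Λ̃ = E₈(−1)^{⊕2} ⊕ U^{⊕4}`).
Along fixed identifications `Λ_n ≅ B₀ ⊕ ⟨−2(n−1)⟩`, `Λ̃ ≅ B₀ ⊕ U` (`B₀ = E₈(−1)^{⊕2} ⊕ U^{⊕3} = H²(S, ℤ)`) the maps
`ι_{r,s}` (`r s = n − 1`, `r > 0`) give a family `I r s : Λ_n → Λ̃` of injective isometric maps such that:
(i) `I r s` has saturated image — is a PRIMITIVE embedding — when `gcd(r, s) = 1`, and not when `gcd(r, s) > 1`;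
(ii) `I r s` and `I r' s'` are in the same `O(Λ̃)`-orbit iff `(r', s') = (r, s)` or `(s, r)` ("one representative from each
`O(U)`-orbit"); (iii) every primitive isometric embedding `κ : Λ_n ↪ Λ̃` is in the `O(Λ̃)`-orbit of some `I r s` with
`r, s` positive coprime, `r s = n − 1` — "The map `(r,s) ↦ ι_{r,s}` induces a one-to-one correspondence, between the
set `𝒫_n` and the set of `O(Λ̃)`-orbits in `O(Λ,Λ̃)`." [cite: Markman2010Constraints, §4.1 Lemma 4.3 (1)] [cite: Markman2011Survey, §9.1.2 Lemma 9.4] -/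
theorem k3HilbertLattice_embedding_mukaiLattice_representatives {n : ℕ} (hn : 2 ≤ n) :
    ∃ I : ℕ → ℕ → ((K3HilbertIndex → ℤ) →ₗ[ℤ] (Fin 2 → Fin 8 → ℤ) × ((Fin 4 → ℤ) × (Fin 4 → ℤ))),
      (∀ r s, 0 < r → r * s = n - 1 →
        Function.Injective (I r s) ∧
        (∀ x y, ((LinearMap.BilinForm.pi fun _ : Fin 2 ↦ -e8Form).prod (hyperbolicSum 4)) (I r s x) (I r s y) =
          Matrix.toBilin' (k3HilbertGram n) x y) ∧
        (Nat.Coprime r s →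
          ∀ (k : ℤ) z, k ≠ 0 → k • z ∈ LinearMap.range (I r s) → z ∈ LinearMap.range (I r s)) ∧
        (1 < Nat.gcd r s →
          ∃ (k : ℤ) (z : (Fin 2 → Fin 8 → ℤ) × ((Fin 4 → ℤ) × (Fin 4 → ℤ))),
            k ≠ 0 ∧ k • z ∈ LinearMap.range (I r s) ∧ z ∉ LinearMap.range (I r s))) ∧
      (∀ r s r' s', 0 < r → 0 < r' →
        ((∃ f : ((LinearMap.BilinForm.pi fun _ : Fin 2 ↦ -e8Form).prod (hyperbolicSum 4)).IsometryEquiv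
            ((LinearMap.BilinForm.pi fun _ : Fin 2 ↦ -e8Form).prod (hyperbolicSum 4)), ∀ p, f (I r s p) = I r' s' p) ↔
          (r' = r ∧ s' = s) ∨ (r' = s ∧ s' = r))) ∧
      ∀ κ : (K3HilbertIndex → ℤ) →ₗ[ℤ] (Fin 2 → Fin 8 → ℤ) × ((Fin 4 → ℤ) × (Fin 4 → ℤ)),
        Function.Injective κ →
        (∀ x y, ((LinearMap.BilinForm.pi fun _ : Fin 2 ↦ -e8Form).prod (hyperbolicSum 4)) (κ x) (κ y) =
          Matrix.toBilin' (k3HilbertGram n) x y) →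
        (∀ (k : ℤ) z, k ≠ 0 → k • z ∈ LinearMap.range κ → z ∈ LinearMap.range κ) →
        ∃ (f : ((LinearMap.BilinForm.pi fun _ : Fin 2 ↦ -e8Form).prod (hyperbolicSum 4)).IsometryEquiv
            ((LinearMap.BilinForm.pi fun _ : Fin 2 ↦ -e8Form).prod (hyperbolicSum 4))) (r s : ℕ),
          0 < r ∧ 0 < s ∧ r * s = n - 1 ∧ Nat.Coprime r s ∧ ∀ p, f (κ p) = I r s p := by
  obtain ⟨ψ⟩ := toBilin'_k3HilbertGram_equivalent_model (n := n) (by omega)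
  obtain ⟨φ⟩ := piNegE8_prod_hyperbolicSum_three_prod_hyperbolicForm_equivalent
  obtain ⟨hsB, heB, huB⟩ := isSymm_isEven_isUnimodular_pi_neg_e8Form_prod_hyperbolicSum' 2 3
  set B₀ : BilinForm ℤ ((Fin 2 → Fin 8 → ℤ) × ((Fin 3 → ℤ) × (Fin 3 → ℤ))) :=
    (LinearMap.BilinForm.pi fun _ : Fin 2 ↦ -e8Form).prod (hyperbolicSum 3) with hB₀
  have hB : B₀.Nondegenerate := huB.nondegenerate
  set I : ℕ → ℕ → ((K3HilbertIndex → ℤ) →ₗ[ℤ] (Fin 2 → Fin 8 → ℤ) × ((Fin 4 → ℤ) × (Fin 4 → ℤ))) := fun r s ↦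
    (φ.toLinearEquiv : _ →ₗ[ℤ] _) ∘ₗ
      ((LinearMap.id : ((Fin 2 → Fin 8 → ℤ) × ((Fin 3 → ℤ) × (Fin 3 → ℤ))) →ₗ[ℤ] _).prodMap
        (LinearMap.toSpanSingleton ℤ (Fin 2 → ℤ) ![(r : ℤ), -(s : ℤ)])) ∘ₗ
      (ψ.toLinearEquiv : _ →ₗ[ℤ] _) with hI
  have hIp : ∀ r s p, I r s p =
      φ (((LinearMap.id : ((Fin 2 → Fin 8 → ℤ) × ((Fin 3 → ℤ) × (Fin 3 → ℤ))) →ₗ[ℤ] _).prodMap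
        (LinearMap.toSpanSingleton ℤ (Fin 2 → ℤ) ![(r : ℤ), -(s : ℤ)])) (ψ p)) := fun _ _ _ ↦ rfl
  have hIrange : ∀ r s, LinearMap.range (I r s) =
      (LinearMap.range (((LinearMap.id : ((Fin 2 → Fin 8 → ℤ) × ((Fin 3 → ℤ) × (Fin 3 → ℤ))) →ₗ[ℤ] _).prodMap
        (LinearMap.toSpanSingleton ℤ (Fin 2 → ℤ) ![(r : ℤ), -(s : ℤ)])))).map
        (φ.toLinearEquiv : _ →ₗ[ℤ] _) := fun r s ↦ by
    rw [hI]
    simp only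
    rw [LinearMap.range_comp, LinearMap.range_comp, LinearEquiv.range, Submodule.map_top]
  refine ⟨I, fun r s hr hrs ↦ ⟨?_, fun x y ↦ ?_, fun hcop k z hk hz ↦ ?_, fun hg ↦ ?_⟩, fun r s r' s' hr hr' ↦ ?_,
    fun κ hκi hκC hκs ↦ ?_⟩
  · -- injective
    exact φ.toLinearEquiv.injective.comp
      ((injective_prodMap_toSpanSingleton_pair r s hr).comp ψ.toLinearEquiv.injective)
  · -- isometric
    rw [hIp, hIp, φ.map_app, prod_hyperbolicForm_apply_prodMap_toSpanSingleton_pair B₀ r s hrs, ψ.map_app]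
  · -- saturated for coprime `r, s`
    rw [hIrange, Submodule.mem_map_equiv] at hz ⊢
    rw [map_smul] at hz
    exact mem_range_prodMap_toSpanSingleton_pair_of_smul_mem r s hr hcop k _ hk hz
  · -- not saturated for `gcd(r, s) > 1`
    obtain ⟨k, z₀, hk, hkz₀, hz₀⟩ :=
      exists_smul_mem_range_prodMap_pair_not_mem (M := (Fin 2 → Fin 8 → ℤ) × ((Fin 3 → ℤ) × (Fin 3 → ℤ)))
        r s hr hg
    refine ⟨k, φ z₀, hk, ?_, fun h ↦ hz₀ ?_⟩
    · rw [hIrange, Submodule.mem_map_equiv, map_smul]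
      change k • φ.toLinearEquiv.symm (φ.toLinearEquiv z₀) ∈ _
      rwa [φ.toLinearEquiv.symm_apply_apply]
    · rw [hIrange, Submodule.mem_map_equiv] at h
      change φ.toLinearEquiv.symm (φ.toLinearEquiv z₀) ∈ _ at h
      rwa [φ.toLinearEquiv.symm_apply_apply] at h
  · -- the orbits: transport of §2
    rw [← exists_isometryEquiv_comp_prodMap_toSpanSingleton_pair_iff B₀ hB hr hr' (s := s) (s' := s')]
    constructor
    · rintro ⟨f, hf⟩
      refine ⟨φ.trans (f.trans φ.symm), fun q ↦ ?_⟩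
      have h := hf (ψ.symm q)
      rw [hIp, hIp, show ψ (ψ.symm q) = q from ψ.toLinearEquiv.apply_symm_apply q] at h
      rw [LinearMap.BilinForm.IsometryEquiv.trans_apply, LinearMap.BilinForm.IsometryEquiv.trans_apply, h]
      exact φ.toLinearEquiv.symm_apply_apply _
    · rintro ⟨f₀, hf₀⟩
      refine ⟨φ.symm.trans (f₀.trans φ), fun p ↦ ?_⟩
      rw [hIp, hIp, LinearMap.BilinForm.IsometryEquiv.trans_apply, LinearMap.BilinForm.IsometryEquiv.trans_apply,
        show φ.symm (φ _) = _ from φ.toLinearEquiv.symm_apply_apply _, hf₀]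
  · -- surjectivity: transport of §3
    set κ₀ : ((Fin 2 → Fin 8 → ℤ) × ((Fin 3 → ℤ) × (Fin 3 → ℤ))) × ℤ →ₗ[ℤ]
        ((Fin 2 → Fin 8 → ℤ) × ((Fin 3 → ℤ) × (Fin 3 → ℤ))) × (Fin 2 → ℤ) :=
      (φ.symm.toLinearEquiv : _ →ₗ[ℤ] _) ∘ₗ κ ∘ₗ (ψ.symm.toLinearEquiv : _ →ₗ[ℤ] _) with hκ₀
    have hκ₀p : ∀ q, κ₀ q = φ.symm (κ (ψ.symm q)) := fun _ ↦ rfl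
    have hκ₀i : Function.Injective κ₀ :=
      φ.symm.toLinearEquiv.injective.comp (hκi.comp ψ.symm.toLinearEquiv.injective)
    have hκ₀C : ∀ p q, (B₀.prod hyperbolicForm) (κ₀ p) (κ₀ q) =
        (B₀.prod ((-(2 * (n - 1 : ℕ) : ℤ)) • LinearMap.mul ℤ ℤ)) p q := fun p q ↦ by
      rw [hκ₀p, hκ₀p, φ.symm.map_app, hκC, ψ.symm.map_app]
    have hκ₀range : LinearMap.range κ₀ = (LinearMap.range κ).map (φ.symm.toLinearEquiv : _ →ₗ[ℤ] _) := by
      rw [hκ₀, LinearMap.range_comp, LinearMap.range_comp, LinearEquiv.range, Submodule.map_top]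
    have hκ₀s : ∀ (k : ℤ) z, k ≠ 0 → k • z ∈ LinearMap.range κ₀ → z ∈ LinearMap.range κ₀ := fun k z hk hz ↦ by
      rw [hκ₀range, Submodule.mem_map_equiv] at hz ⊢
      rw [map_smul] at hz
      exact hκs k _ hk hz
    obtain ⟨f₀, r, s, hr, hs, hrs, hcop, hf₀⟩ :=
      exists_isometryEquiv_comp_eq_prodMap_toSpanSingleton_pair B₀ hsB huB heB (t := n - 1) (by omega) hκ₀i hκ₀C
        hκ₀s
    refine ⟨φ.symm.trans (f₀.trans φ), r, s, hr, hs, hrs, hcop, fun p ↦ ?_⟩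
    have h := hf₀ (ψ p)
    rw [hκ₀p, show ψ.symm (ψ p) = p from ψ.toLinearEquiv.symm_apply_apply p] at h
    rw [hIp, LinearMap.BilinForm.IsometryEquiv.trans_apply, LinearMap.BilinForm.IsometryEquiv.trans_apply, h]

end Literature.AlgebraicGeometry.Hyperkaehler
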